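import Summits.CriticalPhenomena.PercolationContinuityZ3.Theorems.PercNearOneGluingNoHeavyLowerTailSBTensKron
import HarnessLib

/-!
# Scaled-Bernstein tensors III: digit ranges and the recursive digit test (soundness of the packed check)
# (`NoHeavyLowerTail` cell, stmt-CriticalPhenomena-4575; prover `prim-hp-2`, gen 17)

Support file (`--supports stmt-CriticalPhenomena-4575`).  Computable definitions + soundness; no named facts, no sorries.
Continuation of `…SBTensKron` (Kronecker encoding `ienc`, leaf bounds `bnd`):
* `U`, `off`, `U_mul`, `ienc_abs_le`, `ienc_off_range` — with leaves bounded by `R`, `R + 1 ≤ 2^(B-1)`, and list lengths `≤ 4`,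
  `ienc T + off` is a base-`2^(B·4^n)` digit whose base-`2^B` digits are `leaf + 2^(B-1)`;
* `dec B n m` — the recursive digit test (shifts and masks only) and **`dec_sound`**: if it passes on `(ienc T + off).toNat` then
  `allNonneg T` (hence, with `SBTens.eval_nonneg`, the polynomial is `≥ 0` on the unit box).
[folklore: positional number systems]
-/

namespace Summit.CriticalPhenomena.PercolationContinuityZ3.Theorems

namespace SBTens

/-! ## Digit ranges -/

/-- `U B k = Σ_{j < 4^k} 2^(B j)` (recursively). [folklore] -/
def U (B : ℕ) : ℕ → ℕ
  | 0 => 1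
  | k + 1 => U B k * (1 + 2 ^ gexp B k + 2 ^ (2 * gexp B k) + 2 ^ (3 * gexp B k))

/-- The offset putting `2^(B-1)` into every slot. [folklore] -/
def off (B k : ℕ) : ℤ := 2 ^ (B - 1) * U B k

/-- `U B k · (2^B − 1) = 2^(B·4^k) − 1`. [folklore] -/
theorem U_mul (B : ℕ) : ∀ k, (U B k : ℤ) * (2 ^ B - 1) = 2 ^ gexp B k - 1
  | 0 => by simp [U, gexp]
  | k + 1 => by
    have ih := U_mul B k
    have hg : gexp B (k + 1) = 4 * gexp B k := by simp [gexp, pow_succ]; ring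
    simp only [U, Nat.cast_mul, Nat.cast_add, Nat.cast_one, Nat.cast_pow, Nat.cast_ofNat, hg]
    have : (U B k : ℤ) * (1 + 2 ^ gexp B k + 2 ^ (2 * gexp B k) + 2 ^ (3 * gexp B k)) * (2 ^ B - 1) =
        ((U B k : ℤ) * (2 ^ B - 1)) * (1 + 2 ^ gexp B k + 2 ^ (2 * gexp B k) + 2 ^ (3 * gexp B k)) := by ring
    have h2 : (2 : ℤ) ^ (2 * gexp B k) = (2 ^ gexp B k) ^ 2 := by rw [mul_comm, pow_mul]
    have h3 : (2 : ℤ) ^ (3 * gexp B k) = (2 ^ gexp B k) ^ 3 := by rw [mul_comm, pow_mul]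
    have h4 : (2 : ℤ) ^ (4 * gexp B k) = (2 ^ gexp B k) ^ 4 := by rw [mul_comm, pow_mul]
    rw [this, ih, h2, h3, h4]
    ring

/-- Horner bound for a list: `|iencL L| ≤ M · Σ_{i<|L|} 2^(g i)`. [folklore] -/
theorem iencL_abs_le {α : Type} (enc : α → ℤ) (g : ℕ) (M : ℤ) :
    ∀ L : List α, (∀ c ∈ L, |enc c| ≤ M) → |iencL enc g L| ≤ M * ∑ i ∈ Finset.range L.length, (2 : ℤ) ^ (g * i)
  | [], _ => by simp [iencL]
  | c :: C, h => by
    have hc : |enc c| ≤ M := h c (by simp)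
    have ih := iencL_abs_le enc g M C fun c' hc' => h c' (by simp [hc'])
    have h2 : (0 : ℤ) ≤ 2 ^ g := by positivity
    have hsum : ∑ i ∈ Finset.range (C.length + 1), (2 : ℤ) ^ (g * i) =
        (∑ i ∈ Finset.range C.length, (2 : ℤ) ^ (g * i)) * 2 ^ g + 1 := by
      rw [Finset.sum_range_succ', Finset.sum_mul]
      simp only [Nat.mul_zero, pow_zero, Nat.mul_succ, pow_add]
    rw [iencL, ishl_eq, List.length_cons, hsum]
    calc |enc c + iencL enc g C * 2 ^ g| ≤ |enc c| + |iencL enc g C * 2 ^ g| := abs_add_le _ _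
      _ = |enc c| + |iencL enc g C| * 2 ^ g := by rw [abs_mul, abs_of_nonneg h2]
      _ ≤ M + (M * ∑ i ∈ Finset.range C.length, (2 : ℤ) ^ (g * i)) * 2 ^ g :=
          add_le_add hc (mul_le_mul_of_nonneg_right ih h2)
      _ = M * ((∑ i ∈ Finset.range C.length, (2 : ℤ) ^ (g * i)) * 2 ^ g + 1) := by ring

/-- `Σ_{i<ℓ} 2^(g i) ≤ 1 + 2^g + 2^(2g) + 2^(3g)` for `ℓ ≤ 4`. [folklore] -/
theorem sum_pow_le_four (g ℓ : ℕ) (hℓ : ℓ ≤ 4) :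
    ∑ i ∈ Finset.range ℓ, (2 : ℤ) ^ (g * i) ≤ 1 + 2 ^ g + 2 ^ (2 * g) + 2 ^ (3 * g) := by
  have h4 : ∑ i ∈ Finset.range 4, (2 : ℤ) ^ (g * i) = 1 + 2 ^ g + 2 ^ (2 * g) + 2 ^ (3 * g) := by
    simp only [Finset.sum_range_succ, Finset.sum_range_zero, Nat.mul_zero, pow_zero, Nat.mul_one, zero_add]
    rw [Nat.mul_comm g 2, Nat.mul_comm g 3]
  rw [← h4]
  exact Finset.sum_le_sum_of_subset_of_nonneg (Finset.range_mono hℓ) fun i _ _ => by positivity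

/-- Digit range: with leaves bounded by `R` and lengths `≤ 4`, `|ienc T| ≤ R · U`. [folklore] -/
theorem ienc_abs_le (B R : ℕ) : ∀ (n : ℕ) (ds : List ℕ) (T : Tens n), WF n ds T → (∀ d ∈ ds, d ≤ 3) → bnd R n T →
    |ienc B n T| ≤ (R : ℤ) * U B n
  | 0, ds, a, _, _, hb => by
    rw [bnd_zero] at hb
    simp only [ienc, U, Nat.cast_one, mul_one, Int.abs_eq_natAbs]
    exact_mod_cast hb
  | n + 1, [], T, hw, _, _ => absurd hw (WF_succ_nil n T)
  | n + 1, d :: ds, L, hw, hds, hb => by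
    rw [WF_succ] at hw
    rw [bnd_succ] at hb
    have hd : d ≤ 3 := hds d (by simp)
    have hlen : (toList L).length ≤ 4 := by rw [hw.1]; omega
    have hel : ∀ c ∈ toList L, |ienc B n c| ≤ (R : ℤ) * U B n := fun c hc =>
      ienc_abs_le B R n ds c (hw.2 c hc) (fun d' hd' => hds d' (by simp [hd'])) (hb c hc)
    have h1 := iencL_abs_le (ienc B n) (gexp B n) ((R : ℤ) * U B n) (toList L) hel
    have h2 := sum_pow_le_four (gexp B n) _ hlen
    have hRU : (0 : ℤ) ≤ (R : ℤ) * U B n := by positivity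
    calc |ienc B (n + 1) L| = |iencL (ienc B n) (gexp B n) (toList L)| := rfl
      _ ≤ (R : ℤ) * U B n * ∑ i ∈ Finset.range (toList L).length, (2 : ℤ) ^ (gexp B n * i) := h1
      _ ≤ (R : ℤ) * U B n * (1 + 2 ^ gexp B n + 2 ^ (2 * gexp B n) + 2 ^ (3 * gexp B n)) :=
          mul_le_mul_of_nonneg_left h2 hRU
      _ = (R : ℤ) * U B (n + 1) := by simp only [U]; push_cast; ring

/-- The shifted encoding is a base-`2^(B·4^n)` digit: `0 ≤ ienc T + off < 2^(gexp B n)`. [folklore] -/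
theorem ienc_off_range (B R : ℕ) (hB : 1 ≤ B) (hR : (R : ℤ) + 1 ≤ 2 ^ (B - 1)) (n : ℕ) (ds : List ℕ) (T : Tens n)
    (hw : WF n ds T) (hds : ∀ d ∈ ds, d ≤ 3) (hb : bnd R n T) :
    0 ≤ ienc B n T + off B n ∧ ienc B n T + off B n < 2 ^ gexp B n := by
  have h := abs_le.1 (ienc_abs_le B R n ds T hw hds hb)
  have hU := U_mul B n
  have hB2 : (2 : ℤ) ^ B = 2 * 2 ^ (B - 1) := by
    rw [← pow_succ']; congr 1; omega
  have hUpos : (0 : ℤ) ≤ U B n := by positivity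
  constructor
  · rw [off]; nlinarith
  · rw [off]; nlinarith

/-- The offset alone is a digit too. [folklore] -/
theorem off_range (B : ℕ) (hB : 1 ≤ B) (n : ℕ) : 0 ≤ off B n ∧ off B n < 2 ^ gexp B n := by
  have hU := U_mul B n
  have hB2 : (2 : ℤ) ^ B = 2 * 2 ^ (B - 1) := by
    rw [← pow_succ']; congr 1; omega
  have hUpos : (0 : ℤ) ≤ U B n := by positivity
  have h1 : (1 : ℤ) ≤ 2 ^ (B - 1) := one_le_pow₀ (by norm_num)
  refine ⟨by rw [off]; positivity, ?_⟩
  rw [off]; nlinarith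

/-! ## The digit test -/

/-- Recursive base-`2^(B·4^k)` digit test: every slot is `≥ 2^(B-1)` (shifts and masks only). [folklore] -/
def dec (B : ℕ) : ℕ → ℕ → Bool
  | 0, m => decide (2 ^ (B - 1) ≤ m)
  | k + 1, m =>
    let g := gexp B k
    let msk := (1 <<< g) - 1
    let m1 := m >>> g
    let m2 := m1 >>> g
    let m3 := m2 >>> g
    dec B k (m &&& msk) && (dec B k (m1 &&& msk) && (dec B k (m2 &&& msk) && dec B k (m3 &&& msk)))

/-- Horner form of a list of length `≤ 4` with missing entries read as `0`. [folklore] -/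
theorem iencL_four {α : Type} (enc : α → ℤ) (g : ℕ) (L : List α) (hL : L.length ≤ 4) :
    iencL enc g L = ((L[0]?.map enc).getD 0) + 2 ^ g * (((L[1]?.map enc).getD 0) + 2 ^ g *
      (((L[2]?.map enc).getD 0) + 2 ^ g * ((L[3]?.map enc).getD 0))) := by
  match L, hL with
  | [], _ => simp [iencL]
  | [c0], _ => simp [iencL, ishl_eq]
  | [c0, c1], _ => simp [iencL, ishl_eq]; ring
  | [c0, c1, c2], _ => simp [iencL, ishl_eq]; ring
  | [c0, c1, c2, c3], _ => simp [iencL, ishl_eq]; ring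
  | _ :: _ :: _ :: _ :: _ :: _, h => exfalso; simp only [List.length_cons] at h; omega

/-- One base-`2^g` digit step on `ℕ`: low digit by mask, the rest by shift. [folklore] -/
theorem digit_step (g a b : ℕ) (ha : a < 2 ^ g) :
    (a + 2 ^ g * b) &&& ((1 <<< g) - 1) = a ∧ (a + 2 ^ g * b) >>> g = b := by
  have hmsk : (1 <<< g) - 1 = 2 ^ g - 1 := by rw [Nat.shiftLeft_eq, one_mul]
  have hpos : 0 < 2 ^ g := Nat.pos_of_ne_zero (by positivity)
  rw [hmsk, Nat.and_two_pow_sub_one_eq_mod, Nat.shiftRight_eq_div_pow, Nat.add_mul_mod_self_left,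
    Nat.mod_eq_of_lt ha, Nat.add_mul_div_left _ _ hpos, Nat.div_eq_of_lt ha, zero_add]
  exact ⟨rfl, rfl⟩

/-- **Soundness of the digit test.**  Leaves bounded by `R` with `R + 1 ≤ 2^(B-1)`, lengths `≤ 4` (shape entries `≤ 3`):
if `dec` passes on `(ienc T + off).toNat` then every leaf of `T` is `≥ 0`. [folklore] -/
theorem dec_sound (B R : ℕ) (hB : 1 ≤ B) (hR : (R : ℤ) + 1 ≤ 2 ^ (B - 1)) :
    ∀ (n : ℕ) (ds : List ℕ) (T : Tens n), WF n ds T → (∀ d ∈ ds, d ≤ 3) → bnd R n T →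
      dec B n (ienc B n T + off B n).toNat = true → allNonneg n T = true
  | 0, ds, a, _, _, hb, hdec => by
    rw [bnd_zero] at hb
    simp only [dec, decide_eq_true_eq] at hdec
    simp only [allNonneg, decide_eq_true_eq]
    have hnn : 0 ≤ ienc B 0 a + off B 0 := by
      simp only [ienc, off, U, Nat.cast_one, mul_one]
      have h := abs_le.1 (show |toInt a| ≤ (R : ℤ) by rw [Int.abs_eq_natAbs]; exact_mod_cast hb)
      linarith
    have hcast : ((ienc B 0 a + off B 0).toNat : ℤ) = ienc B 0 a + off B 0 := Int.toNat_of_nonneg hnn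
    have h2 : ((2 ^ (B - 1) : ℕ) : ℤ) ≤ ((ienc B 0 a + off B 0).toNat : ℤ) := by exact_mod_cast hdec
    rw [hcast] at h2
    simp only [ienc, off, U, Nat.cast_one, mul_one, Nat.cast_pow, Nat.cast_ofNat] at h2
    linarith
  | n + 1, [], T, hw, _, _, _ => absurd hw (WF_succ_nil n T)
  | n + 1, d :: ds, L, hw, hds, hb, hdec => by
    rw [WF_succ] at hw
    rw [bnd_succ] at hb
    have hd : d ≤ 3 := hds d (by simp)
    have hds' : ∀ d' ∈ ds, d' ≤ 3 := fun d' hd' => hds d' (by simp [hd'])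
    have hlen : (toList L).length ≤ 4 := by rw [hw.1]; omega
    set g := gexp B n with hg
    -- the four digits (as integers)
    let E : ℕ → ℤ := fun i => ((toList L)[i]?.map (ienc B n)).getD 0
    let t : ℕ → ℤ := fun i => E i + off B n
    have ht : ∀ i, 0 ≤ t i ∧ t i < 2 ^ g := by
      intro i
      show 0 ≤ E i + off B n ∧ E i + off B n < 2 ^ g
      simp only [E]
      cases hi : (toList L)[i]? with
      | none => simpa using off_range B hB n
      | some c =>
        have hc : c ∈ toList L := List.mem_of_getElem? hi
        simpa using ienc_off_range B R hB hR n ds c (hw.2 c hc) hds' (hb c hc)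
    -- dec on a digit coming from an entry gives nonnegativity of that entry
    have hentry : ∀ i c, (toList L)[i]? = some c → dec B n (t i).toNat = true → allNonneg n c = true := by
      intro i c hi hdeci
      have hc : c ∈ toList L := List.mem_of_getElem? hi
      have : t i = ienc B n c + off B n := by show E i + off B n = _; simp [E, hi]
      rw [this] at hdeci
      exact dec_sound B R hB hR n ds c (hw.2 c hc) hds' (hb c hc) hdeci
    -- the number handed to `dec`
    have hN : ienc B (n + 1) L + off B (n + 1) = t 0 + 2 ^ g * (t 1 + 2 ^ g * (t 2 + 2 ^ g * t 3)) := by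
      show iencL (ienc B n) (gexp B n) (toList L) + off B (n + 1) =
        (E 0 + off B n) + 2 ^ g * ((E 1 + off B n) + 2 ^ g * ((E 2 + off B n) + 2 ^ g * (E 3 + off B n)))
      rw [iencL_four _ _ _ hlen, off, off]
      simp only [U, hg, E]
      push_cast
      ring
    have hNn : 0 ≤ ienc B (n + 1) L + off B (n + 1) := by
      rw [hN]
      have p2 : (0 : ℤ) ≤ 2 ^ g := by positivity
      exact add_nonneg (ht 0).1 (mul_nonneg p2 (add_nonneg (ht 1).1 (mul_nonneg p2
        (add_nonneg (ht 2).1 (mul_nonneg p2 (ht 3).1)))))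
    -- pass to ℕ
    set a : ℕ → ℕ := fun i => (t i).toNat with ha
    have hai : ∀ i, (a i : ℤ) = t i := fun i => Int.toNat_of_nonneg (ht i).1
    have halt : ∀ i, a i < 2 ^ g := fun i => by
      have := (ht i).2; have := hai i; exact_mod_cast (this ▸ (ht i).2 : (a i : ℤ) < 2 ^ g)
    have hm : (ienc B (n + 1) L + off B (n + 1)).toNat = a 0 + 2 ^ g * (a 1 + 2 ^ g * (a 2 + 2 ^ g * a 3)) := by
      have hz : (((ienc B (n + 1) L + off B (n + 1)).toNat : ℕ) : ℤ) =
          ((a 0 + 2 ^ g * (a 1 + 2 ^ g * (a 2 + 2 ^ g * a 3)) : ℕ) : ℤ) := by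
        rw [Int.toNat_of_nonneg hNn, hN]
        push_cast
        rw [hai, hai, hai, hai]
      exact_mod_cast hz
    -- unfold the test
    rw [hm] at hdec
    simp only [dec, Bool.and_eq_true] at hdec
    obtain ⟨h0, h1, h2, h3⟩ := hdec
    obtain ⟨e0, s0⟩ := digit_step g (a 0) _ (halt 0)
    obtain ⟨e1, s1⟩ := digit_step g (a 1) _ (halt 1)
    obtain ⟨e2, s2⟩ := digit_step g (a 2) _ (halt 2)
    have e3 : a 3 &&& ((1 <<< g) - 1) = a 3 := by
      have := (digit_step g (a 3) 0 (halt 3)).1; simpa using this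
    rw [← hg] at h0 h1 h2 h3
    rw [e0] at h0
    rw [s0, e1] at h1
    rw [s0, s1, e2] at h2
    rw [s0, s1, s2, e3] at h3
    -- every entry sits at one of the four digit positions
    simp only [allNonneg, List.all_eq_true]
    intro c hc
    obtain ⟨i, hi, hic⟩ := List.mem_iff_getElem.1 hc
    have hi4 : i < 4 := lt_of_lt_of_le hi hlen
    have hget : (toList L)[i]? = some c := by rw [List.getElem?_eq_getElem hi, hic]
    interval_cases i
    · exact hentry 0 c hget h0
    · exact hentry 1 c hget h1
    · exact hentry 2 c hget h2
    · exact hentry 3 c hget h3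

end SBTens

end Summit.CriticalPhenomena.PercolationContinuityZ3.Theorems
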